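import Mathlib
import HarnessLib

/-!
# Venture HSemireg — the Φ-law of the sliver OFF THE FLAT LOCUS: `K₄ − ΣpM` in moments and the `|S| = 4` dictionary for LEVEL-UNIFORM margins (W5 seat w5-n6-2 gen 19)

Bookkeeping of the computation cell `pub-hsemireg`, group W5 (notes `widen/W5/N7-FEASIBILITY-w5n7.md` §3.6 (a) and
§3.8 (a), `widen/W5/SLIVER-w5n62g18.md` §0 ∕ §7, `widen/W5/KERNEL-M-w5n62g19.md` §10; deposit
`widen/W5/n6code2/v22/window/`). Companion of `FlatIndependentTransversals.lean` (the flat dictionary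
«`I = A₄` ⇒ Φ-law»), `UniformMarginMomentIdentity.lean` (THEOREM M⁺) and
`UniformMarginIndependentTransversals.lean` (THEOREM L′⁺); PLAIN and independent of all of them (nothing of
the tree imported or restated; the Fubini steps and the pointwise expansion are local `have`s).

SETTING (N7F §3.6 (a), LEMMA U). Four finite level types `A, B, C, D`, margin functions `μ_X : X → R` over
a commutative ring with `Σ_ξ μ_X(ξ) = m` on `A, B, C`, six torus matrices `xAB, …, xCD` whose line sums
through a level are that level's margin in each of the three matrices through it (LEVEL-UNIFORM margins).
Notation (sums over transversals `(a,b,c,e)`): `K₄` = all six tori, `ΣpM` = exactly a perfect matching;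
`C_X = Σ μ_X³`, `B_XY = Σ μ_X·xXY·μ_Y` (the `ΣB`, `ΣC` of N7F §3.8 (a)); `ΣPaw` the twelve weighted
triangle sums `Σ_{triangle} μ_V(v)` (N7F's `Σ_(12) Paw`); and the RAW MONOMIAL SUMS `N(C₄)` (the three
4-cycles `AB·BC·CD·DA`, `AB·BD·DC·CA`, `AC·CB·BD·DA`), `F₅` (the six five-torus monomials, one per missing
torus; for `0 ∕ 1` data `= Σ_{(β,γ)} t_x(β,γ)·t_w(β,γ)` of N7F by distributivity) and `N(K₄)`.

* `phiMoment_margin` — the identity `K₄ − ΣpM = −3m² + 2ΣB − ΣPaw − 2ΣN(C₄) + 2ΣF₅ − 2N(K₄)`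
  (pointwise, `[all six] − [exactly a perfect matching]` has monomial coefficients `−1` on the matchings,
  `+1` on the 3-paths, `−1` on the paws, `−2, +2, −2` on the 4-cycles, `K₄ ∖ e`, `K₄`, and `0` elsewhere;
  then Fubini leaves-first: matching `↦ m²`, 3-path `↦ B` of its middle torus, paw `↦` weighted triangle).
* `phi_law_of_fourSet` — **the DICTIONARY off the flat locus**: the `|S| = 4` class equation of a
  `K`-secant skeleton with level-uniform margins AS PRINTED in N7F §3.8 (a),
  `m(s² − m) = −3m² + 2ΣB + ΣC − ΣN(C₄) − ΣPaw + ΣF₅ − N(K₄)`, gives the **Φ⁺-law**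
  `K₄ − ΣpM = m² + 2 m s² − 2ΣB − 2ΣC + ΣPaw`. At `μ ≡ d`, `t_X = t` (`m = t d`, `B = C = t d³`,
  `ΣPaw = 3d·ΣT = 12 t d² σ`, `s = σ − 3d`) this is `2 t d σ² + t d² (t − 2d)`, the flat Φ-law of
  `FlatIndependentTransversals.phi_law_of_independent_count` ∕ `FlatMomentWindow`. The window it yields
  with THEOREM M⁺ is `UniformMarginWindow.lean`.

HONEST FRAMING: finite sums and ring arithmetic only. The class equation is a HYPOTHESIS here, quoted as
printed in the cell's notes (that a K-secant pure coordinate skeleton with level-uniform margins satisfies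
it is N7-FEASIBILITY §3.1 ∕ §3.6 ∕ §3.8, text). Nothing in this file says that HC, HC_CM or HC_AV holds;
no door ∕ tier ∕ report sentence of the cell is a consequence of this file alone.
-/

namespace Summit.Ventures.HSemireg
namespace UniformMarginPhiLaw
open Finset

section Identity
variable {R : Type*} [CommRing R]
variable {A B C D : Type*} [Fintype A] [Fintype B] [Fintype C] [Fintype D]

/-- **`K₄ − ΣpM` in moments, level-uniform margins.** Margin functions `μA … μD` with totals `m` on
`A, B, C`, six matrices whose line sums through a level are that level's margin. Summed over transversals,
`[all six tori] − [exactly a perfect matching] = −3m² + 2ΣB − ΣPaw − 2ΣN(C₄) + 2ΣF₅ − 2N(K₄)`, the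
bilinear moments, the twelve weighted triangle sums and the ten raw monomial sums written in the shape
the summation leaves them. -/
theorem phiMoment_margin (m : R) (μA : A → R) (μB : B → R) (μC : C → R) (μD : D → R)
    (xAB : A → B → R) (xAC : A → C → R) (xAD : A → D → R)
    (xBC : B → C → R) (xBD : B → D → R) (xCD : C → D → R)
    (hmA : ∑ a, μA a = m) (hmB : ∑ b, μB b = m) (hmC : ∑ c, μC c = m)
    (rAB : ∀ a, ∑ b, xAB a b = μA a) (cAB : ∀ b, ∑ a, xAB a b = μB b)
    (rAC : ∀ a, ∑ c, xAC a c = μA a) (cAC : ∀ c, ∑ a, xAC a c = μC c)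
    (rAD : ∀ a, ∑ e, xAD a e = μA a) (cAD : ∀ e, ∑ a, xAD a e = μD e)
    (rBC : ∀ b, ∑ c, xBC b c = μB b) (cBC : ∀ c, ∑ b, xBC b c = μC c)
    (rBD : ∀ b, ∑ e, xBD b e = μB b) (cBD : ∀ e, ∑ b, xBD b e = μD e)
    (rCD : ∀ c, ∑ e, xCD c e = μC c) (cCD : ∀ e, ∑ c, xCD c e = μD e) :
    (∑ a, ∑ b, ∑ c, ∑ e, xAB a b * xAC a c * xAD a e * xBC b c * xBD b e * xCD c e)
      - (∑ a, ∑ b, ∑ c, ∑ e,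
          (xAB a b * xCD c e * (1 - xAC a c) * (1 - xAD a e) * (1 - xBC b c) * (1 - xBD b e)
          + xAC a c * xBD b e * (1 - xAB a b) * (1 - xAD a e) * (1 - xBC b c) * (1 - xCD c e)
          + xAD a e * xBC b c * (1 - xAB a b) * (1 - xAC a c) * (1 - xBD b e) * (1 - xCD c e)))
      = - 3 * m ^ 2
        + 2 * ((∑ a, ∑ b, μA a * xAB a b * μB b) + (∑ a, ∑ c, μA a * xAC a c * μC c)
          + (∑ a, ∑ e, μA a * xAD a e * μD e) + (∑ b, ∑ c, μB b * xBC b c * μC c)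
          + (∑ b, ∑ e, μB b * xBD b e * μD e) + (∑ c, ∑ e, μC c * xCD c e * μD e))
        - ((∑ a, (∑ b, ∑ c, xAB a b * xAC a c * xBC b c) * μA a)
          + (∑ a, ∑ b, (∑ c, xAB a b * xAC a c * xBC b c) * μB b)
          + (∑ a, ∑ b, ∑ c, xAB a b * xAC a c * xBC b c * μC c)
          + (∑ a, (∑ b, ∑ e, xAB a b * xAD a e * xBD b e) * μA a)
          + (∑ a, ∑ b, (∑ e, xAB a b * xAD a e * xBD b e) * μB b)
          + (∑ a, ∑ b, ∑ e, xAB a b * xAD a e * xBD b e * μD e)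
          + (∑ a, (∑ c, ∑ e, xAC a c * xAD a e * xCD c e) * μA a)
          + (∑ a, ∑ c, (∑ e, xAC a c * xAD a e * xCD c e) * μC c)
          + (∑ a, ∑ c, ∑ e, xAC a c * xAD a e * xCD c e * μD e)
          + (∑ b, (∑ c, ∑ e, xBC b c * xBD b e * xCD c e) * μB b)
          + (∑ b, ∑ c, (∑ e, xBC b c * xBD b e * xCD c e) * μC c)
          + (∑ b, ∑ c, ∑ e, xBC b c * xBD b e * xCD c e * μD e))
        - 2 * ((∑ a, ∑ b, ∑ c, ∑ e, xAB a b * xAD a e * xBC b c * xCD c e)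
          + (∑ a, ∑ b, ∑ c, ∑ e, xAB a b * xAC a c * xBD b e * xCD c e)
          + (∑ a, ∑ b, ∑ c, ∑ e, xAC a c * xAD a e * xBC b c * xBD b e))
        + 2 * ((∑ a, ∑ b, ∑ c, ∑ e, xAC a c * xAD a e * xBC b c * xBD b e * xCD c e)
          + (∑ a, ∑ b, ∑ c, ∑ e, xAB a b * xAD a e * xBC b c * xBD b e * xCD c e)
          + (∑ a, ∑ b, ∑ c, ∑ e, xAB a b * xAC a c * xBC b c * xBD b e * xCD c e)
          + (∑ a, ∑ b, ∑ c, ∑ e, xAB a b * xAC a c * xAD a e * xBD b e * xCD c e)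
          + (∑ a, ∑ b, ∑ c, ∑ e, xAB a b * xAC a c * xAD a e * xBC b c * xCD c e)
          + (∑ a, ∑ b, ∑ c, ∑ e, xAB a b * xAC a c * xAD a e * xBC b c * xBD b e))
        - 2 * (∑ a, ∑ b, ∑ c, ∑ e, xAB a b * xAC a c * xAD a e * xBC b c * xBD b e * xCD c e) := by
  -- Fubini, local (leaves-first orders)
  have sum4_swap34 : ∀ f : A → B → C → D → R,
      ∑ a, ∑ b, ∑ c, ∑ e, f a b c e = ∑ a, ∑ b, ∑ e, ∑ c, f a b c e :=
    fun f => Finset.sum_congr rfl fun _ _ => Finset.sum_congr rfl fun _ _ => Finset.sum_comm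
  have sum4_in2 : ∀ f : A → B → C → D → R,
      ∑ a, ∑ b, ∑ c, ∑ e, f a b c e = ∑ a, ∑ c, ∑ e, ∑ b, f a b c e :=
    fun f => Finset.sum_congr rfl fun _ _ =>
      Finset.sum_comm.trans (Finset.sum_congr rfl fun _ _ => Finset.sum_comm)
  have sum4_in1 : ∀ f : A → B → C → D → R,
      ∑ a, ∑ b, ∑ c, ∑ e, f a b c e = ∑ b, ∑ c, ∑ e, ∑ a, f a b c e :=
    fun f => Finset.sum_comm.trans (Finset.sum_congr rfl fun _ _ =>
      Finset.sum_comm.trans (Finset.sum_congr rfl fun _ _ => Finset.sum_comm))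
  have sum4_ae : ∀ f : A → B → C → D → R,
      ∑ a, ∑ b, ∑ c, ∑ e, f a b c e = ∑ a, ∑ e, ∑ b, ∑ c, f a b c e :=
    fun f => Finset.sum_congr rfl fun _ _ =>
      (Finset.sum_congr rfl fun _ _ => Finset.sum_comm).trans Finset.sum_comm
  have sum4_be : ∀ f : A → B → C → D → R,
      ∑ a, ∑ b, ∑ c, ∑ e, f a b c e = ∑ b, ∑ e, ∑ c, ∑ a, f a b c e :=
    fun f => (sum4_in1 f).trans (Finset.sum_congr rfl fun _ _ => Finset.sum_comm)
  have sum4_ce : ∀ f : A → B → C → D → R,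
      ∑ a, ∑ b, ∑ c, ∑ e, f a b c e = ∑ c, ∑ e, ∑ b, ∑ a, f a b c e :=
    fun f => (sum4_in1 f).trans
      (Finset.sum_comm.trans (Finset.sum_congr rfl fun _ _ => Finset.sum_comm))
  -- pointwise: [all six] − [exactly a perfect matching] in monomials (3-paths ends-outside)
  have hpt : ∀ x1 x2 x3 x4 x5 x6 : R,
      x1 * x2 * x3 * x4 * x5 * x6
        - (x1 * x6 * (1 - x2) * (1 - x3) * (1 - x4) * (1 - x5)
          + x2 * x5 * (1 - x1) * (1 - x3) * (1 - x4) * (1 - x6)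
          + x3 * x4 * (1 - x1) * (1 - x2) * (1 - x5) * (1 - x6))
      = - (x1 * x6 + x2 * x5 + x3 * x4)
        + (x2 * x1 * x5 + x3 * x1 * x4 + x1 * x2 * x6 + x3 * x2 * x4 + x1 * x3 * x6 + x2 * x3 * x5
          + x1 * x4 * x6 + x5 * x4 * x2 + x1 * x5 * x6 + x4 * x5 * x3 + x2 * x6 * x5 + x4 * x6 * x3)
        - (x1 * x2 * x4 * x3 + x1 * x2 * x4 * x5 + x1 * x2 * x4 * x6
          + x1 * x3 * x5 * x2 + x1 * x3 * x5 * x4 + x1 * x3 * x5 * x6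
          + x2 * x3 * x6 * x1 + x2 * x3 * x6 * x4 + x2 * x3 * x6 * x5
          + x4 * x5 * x6 * x1 + x4 * x5 * x6 * x2 + x4 * x5 * x6 * x3)
        - 2 • (x1 * x3 * x4 * x6 + x1 * x2 * x5 * x6 + x2 * x3 * x4 * x5)
        + 2 • (x2 * x3 * x4 * x5 * x6 + x1 * x3 * x4 * x5 * x6 + x1 * x2 * x4 * x5 * x6
          + x1 * x2 * x3 * x5 * x6 + x1 * x2 * x3 * x4 * x6 + x1 * x2 * x3 * x4 * x5)
        - 2 • (x1 * x2 * x3 * x4 * x5 * x6) := by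
    intros; simp only [nsmul_eq_mul, Nat.cast_ofNat]; ring
  simp only [← sum_sub_distrib]
  simp_rw [hpt]
  simp only [sum_add_distrib, sum_sub_distrib, sum_neg_distrib, ← smul_sum]
  -- leaves first (3-paths: both ends; paws: the pendant end)
  rw [sum4_in2 fun a b c e => xAB a b * xAC a c * xCD c e,
    sum4_in2 fun a b c e => xAD a e * xAC a c * xBC b c,
    sum4_ae fun a b c e => xAB a b * xAD a e * xCD c e,
    sum4_ae fun a b c e => xAC a c * xAD a e * xBD b e,
    sum4_in1 fun a b c e => xAB a b * xBC b c * xCD c e,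
    sum4_in1 fun a b c e => xBD b e * xBC b c * xAC a c,
    sum4_be fun a b c e => xAB a b * xBD b e * xCD c e,
    sum4_be fun a b c e => xBC b c * xBD b e * xAD a e,
    sum4_ce fun a b c e => xAC a c * xCD c e * xBD b e,
    sum4_ce fun a b c e => xBC b c * xCD c e * xAD a e,
    sum4_swap34 fun a b c e => xAB a b * xAD a e * xBD b e * xCD c e,
    sum4_in2 fun a b c e => xAC a c * xAD a e * xCD c e * xBC b c,
    sum4_in2 fun a b c e => xAC a c * xAD a e * xCD c e * xBD b e,
    sum4_in1 fun a b c e => xBC b c * xBD b e * xCD c e * xAB a b,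
    sum4_in1 fun a b c e => xBC b c * xBD b e * xCD c e * xAC a c,
    sum4_in1 fun a b c e => xBC b c * xBD b e * xCD c e * xAD a e]
  simp only [← mul_sum, ← sum_mul, rAB, cAB, rAC, cAC, rAD, cAD, rBC, cBC, rBD, cBD, rCD, cCD,
    hmA, hmB, hmC, nsmul_eq_mul, Nat.cast_ofNat]
  ring

/-- **The DICTIONARY off the flat locus (`|S| = 4` class equation ⇒ Φ⁺-law).** Same data and a
parameter `s`. If the `|S| = 4` class equation of N7-FEASIBILITY §3.8 (a) holds as printed,
`m (s² − m) = −3m² + 2ΣB + ΣC − ΣN(C₄) − ΣPaw + ΣF₅ − N(K₄)` (raw monomial sums for the 4-cycles, the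
five-torus monomials and `K₄`), then `K₄ − ΣpM = m² + 2 m s² − 2ΣB − 2ΣC + ΣPaw`. -/
theorem phi_law_of_fourSet (m s : R) (μA : A → R) (μB : B → R) (μC : C → R) (μD : D → R)
    (xAB : A → B → R) (xAC : A → C → R) (xAD : A → D → R)
    (xBC : B → C → R) (xBD : B → D → R) (xCD : C → D → R)
    (hmA : ∑ a, μA a = m) (hmB : ∑ b, μB b = m) (hmC : ∑ c, μC c = m)
    (rAB : ∀ a, ∑ b, xAB a b = μA a) (cAB : ∀ b, ∑ a, xAB a b = μB b)
    (rAC : ∀ a, ∑ c, xAC a c = μA a) (cAC : ∀ c, ∑ a, xAC a c = μC c)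
    (rAD : ∀ a, ∑ e, xAD a e = μA a) (cAD : ∀ e, ∑ a, xAD a e = μD e)
    (rBC : ∀ b, ∑ c, xBC b c = μB b) (cBC : ∀ c, ∑ b, xBC b c = μC c)
    (rBD : ∀ b, ∑ e, xBD b e = μB b) (cBD : ∀ e, ∑ b, xBD b e = μD e)
    (rCD : ∀ c, ∑ e, xCD c e = μC c) (cCD : ∀ e, ∑ c, xCD c e = μD e)
    (h4 : m * (s ^ 2 - m)
      = - 3 * m ^ 2
        + 2 * ((∑ a, ∑ b, μA a * xAB a b * μB b) + (∑ a, ∑ c, μA a * xAC a c * μC c)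
          + (∑ a, ∑ e, μA a * xAD a e * μD e) + (∑ b, ∑ c, μB b * xBC b c * μC c)
          + (∑ b, ∑ e, μB b * xBD b e * μD e) + (∑ c, ∑ e, μC c * xCD c e * μD e))
        + ((∑ a, μA a * μA a * μA a) + (∑ b, μB b * μB b * μB b)
          + (∑ c, μC c * μC c * μC c) + (∑ e, μD e * μD e * μD e))
        - ((∑ a, ∑ b, ∑ c, ∑ e, xAB a b * xAD a e * xBC b c * xCD c e)
          + (∑ a, ∑ b, ∑ c, ∑ e, xAB a b * xAC a c * xBD b e * xCD c e)
          + (∑ a, ∑ b, ∑ c, ∑ e, xAC a c * xAD a e * xBC b c * xBD b e))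
        - ((∑ a, (∑ b, ∑ c, xAB a b * xAC a c * xBC b c) * μA a)
          + (∑ a, ∑ b, (∑ c, xAB a b * xAC a c * xBC b c) * μB b)
          + (∑ a, ∑ b, ∑ c, xAB a b * xAC a c * xBC b c * μC c)
          + (∑ a, (∑ b, ∑ e, xAB a b * xAD a e * xBD b e) * μA a)
          + (∑ a, ∑ b, (∑ e, xAB a b * xAD a e * xBD b e) * μB b)
          + (∑ a, ∑ b, ∑ e, xAB a b * xAD a e * xBD b e * μD e)
          + (∑ a, (∑ c, ∑ e, xAC a c * xAD a e * xCD c e) * μA a)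
          + (∑ a, ∑ c, (∑ e, xAC a c * xAD a e * xCD c e) * μC c)
          + (∑ a, ∑ c, ∑ e, xAC a c * xAD a e * xCD c e * μD e)
          + (∑ b, (∑ c, ∑ e, xBC b c * xBD b e * xCD c e) * μB b)
          + (∑ b, ∑ c, (∑ e, xBC b c * xBD b e * xCD c e) * μC c)
          + (∑ b, ∑ c, ∑ e, xBC b c * xBD b e * xCD c e * μD e))
        + ((∑ a, ∑ b, ∑ c, ∑ e, xAC a c * xAD a e * xBC b c * xBD b e * xCD c e)
          + (∑ a, ∑ b, ∑ c, ∑ e, xAB a b * xAD a e * xBC b c * xBD b e * xCD c e)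
          + (∑ a, ∑ b, ∑ c, ∑ e, xAB a b * xAC a c * xBC b c * xBD b e * xCD c e)
          + (∑ a, ∑ b, ∑ c, ∑ e, xAB a b * xAC a c * xAD a e * xBD b e * xCD c e)
          + (∑ a, ∑ b, ∑ c, ∑ e, xAB a b * xAC a c * xAD a e * xBC b c * xCD c e)
          + (∑ a, ∑ b, ∑ c, ∑ e, xAB a b * xAC a c * xAD a e * xBC b c * xBD b e))
        - (∑ a, ∑ b, ∑ c, ∑ e, xAB a b * xAC a c * xAD a e * xBC b c * xBD b e * xCD c e)) :
    (∑ a, ∑ b, ∑ c, ∑ e, xAB a b * xAC a c * xAD a e * xBC b c * xBD b e * xCD c e)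
      - (∑ a, ∑ b, ∑ c, ∑ e,
          (xAB a b * xCD c e * (1 - xAC a c) * (1 - xAD a e) * (1 - xBC b c) * (1 - xBD b e)
          + xAC a c * xBD b e * (1 - xAB a b) * (1 - xAD a e) * (1 - xBC b c) * (1 - xCD c e)
          + xAD a e * xBC b c * (1 - xAB a b) * (1 - xAC a c) * (1 - xBD b e) * (1 - xCD c e)))
      = m ^ 2 + 2 * m * s ^ 2
        - 2 * ((∑ a, ∑ b, μA a * xAB a b * μB b) + (∑ a, ∑ c, μA a * xAC a c * μC c)
          + (∑ a, ∑ e, μA a * xAD a e * μD e) + (∑ b, ∑ c, μB b * xBC b c * μC c)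
          + (∑ b, ∑ e, μB b * xBD b e * μD e) + (∑ c, ∑ e, μC c * xCD c e * μD e))
        - 2 * ((∑ a, μA a * μA a * μA a) + (∑ b, μB b * μB b * μB b)
          + (∑ c, μC c * μC c * μC c) + (∑ e, μD e * μD e * μD e))
        + ((∑ a, (∑ b, ∑ c, xAB a b * xAC a c * xBC b c) * μA a)
          + (∑ a, ∑ b, (∑ c, xAB a b * xAC a c * xBC b c) * μB b)
          + (∑ a, ∑ b, ∑ c, xAB a b * xAC a c * xBC b c * μC c)
          + (∑ a, (∑ b, ∑ e, xAB a b * xAD a e * xBD b e) * μA a)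
          + (∑ a, ∑ b, (∑ e, xAB a b * xAD a e * xBD b e) * μB b)
          + (∑ a, ∑ b, ∑ e, xAB a b * xAD a e * xBD b e * μD e)
          + (∑ a, (∑ c, ∑ e, xAC a c * xAD a e * xCD c e) * μA a)
          + (∑ a, ∑ c, (∑ e, xAC a c * xAD a e * xCD c e) * μC c)
          + (∑ a, ∑ c, ∑ e, xAC a c * xAD a e * xCD c e * μD e)
          + (∑ b, (∑ c, ∑ e, xBC b c * xBD b e * xCD c e) * μB b)
          + (∑ b, ∑ c, (∑ e, xBC b c * xBD b e * xCD c e) * μC c)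
          + (∑ b, ∑ c, ∑ e, xBC b c * xBD b e * xCD c e * μD e)) := by
  have hA := phiMoment_margin m μA μB μC μD xAB xAC xAD xBC xBD xCD hmA hmB hmC rAB cAB rAC cAC
    rAD cAD rBC cBC rBD cBD rCD cCD
  linear_combination hA - 2 * h4

end Identity

end UniformMarginPhiLaw
end Summit.Ventures.HSemireg
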